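import Summits.CriticalPhenomena.PercolationContinuityZ3.Theorems.PercNearOneGluingNoHeavyLowerTailSuperTerminalQuarticHubGraphs
import Summits.CriticalPhenomena.PercolationContinuityZ3.Theorems.PercNearOneGluingNoHeavyLowerTailSuperTerminalQuarticTermPairs
import Summits.CriticalPhenomena.PercolationContinuityZ3.Theorems.PercNearOneGluingNoHeavyLowerTailSuperTerminalQuarticTermPiece
import HarnessLib

/-!
# THEOREM H4 (vertex-cover form): `V4` on every finite weighted graph in which `{c,u,a,b}` is a vertex cover (THEOREM H4, part 4b)

Support file for crux `stmt-CriticalPhenomena-4575` (`NoHeavyLowerTail`), seat `prim-facecert` gen 21 (`--supports stmt-CriticalPhenomena-4575`);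
memo `run/shared/lean/prim/prim-l12/prim-facecert/FINDING-gen21-V4-HUB-GRAPHS.md`.  No sorries, standard axioms.

`superTerminalQuartic_vertexCover`: as `SuperTerminalQuarticHubGraphs.superTerminalQuartic_hubGraph` but WITHOUT the hypothesis that the
terminal–terminal pairs have weight `0`: the six terminal pairs form one more piece (`…SuperTerminalQuarticTermPiece.termPiece`), appended
after the hubs.  [this work]
-/

namespace Summit.CriticalPhenomena.PercolationContinuityZ3.Theorems.SuperTerminalQuarticHubGraphsVC

open MeasureTheory Set Finset
open Literature.Probability.Percolation Literature.Probability.LatticeModels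
open Summit.CriticalPhenomena.PercolationContinuityZ3.Theorems.SuperTerminalQuarticHubEvents
open Summit.CriticalPhenomena.PercolationContinuityZ3.Theorems.SuperTerminalQuarticHubProb
open Summit.CriticalPhenomena.PercolationContinuityZ3.Theorems.SuperTerminalQuarticHubCylinders
open Summit.CriticalPhenomena.PercolationContinuityZ3.Theorems.SuperTerminalQuarticHubGraphs
open Summit.CriticalPhenomena.PercolationContinuityZ3.Theorems.SuperTerminalQuarticTermPairs
open Summit.CriticalPhenomena.PercolationContinuityZ3.Theorems.SuperTerminalQuarticTermPiece
open scoped Classical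

variable {V : Type*} [Fintype V] [DecidableEq V]

section products
variable (w : Sym2 V → unitInterval) {c u a b : V}

/-- Product formula keeping the terminal factor: `P((T₁ ∩ T₂ ∩ T₃) ∩ ⋂_h H h) = P(T₁ ∩ T₂ ∩ T₃) · Π_h P(H h)` for terminal parts `tSep`. [this work] -/
theorem real_t3_hInter {X Y Z : Finset V} (hX : X ⊆ terms4 c u a b) (hY : Y ⊆ terms4 c u a b) (hZ : Z ⊆ terms4 c u a b)
    {H : V → Set (BondConfig V)} (hH : ∀ h ∈ hubs4 c u a b, DeterminedBy (H h) (↑(star4 c u a b h) : Set (Sym2 V))) :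
    (prodBernoulli w).real ((tSep X c u a b ∩ tSep Y c u a b ∩ tSep Z c u a b) ∩ ⋂ h ∈ hubs4 c u a b, H h) =
      (prodBernoulli w).real (tSep X c u a b ∩ tSep Y c u a b ∩ tSep Z c u a b) * ∏ h ∈ hubs4 c u a b, (prodBernoulli w).real (H h) := by
  refine real_tInter_hInter w (fun ω ω' hF => ?_) hH
  simp only [mem_inter_iff]
  rw [tSep_dep hX hF, tSep_dep hY hF, tSep_dep hZ hF]

/-- `P(Q) = P(T_cb)·Π(n+p) − P(T_cbu)·Π n` (terminal factors kept). [this work] -/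
theorem real_Q_vc (hcu : c ≠ u) (hca : c ≠ a) (hcb : c ≠ b) (hua : u ≠ a) (hub : u ≠ b) (hab : a ≠ b)
    (hcov : ∀ x ∈ hubs4 c u a b, ∀ y ∈ hubs4 c u a b, x ≠ y → (w s(x, y) : ℝ) = 0) :
    (prodBernoulli w).real (openConn u a ∩ (openConn u b)ᶜ ∩ ((openConn c u)ᶜ ∩ (openConn c a)ᶜ ∩ (openConn c b)ᶜ) : Set (BondConfig V)) =
      (prodBernoulli w).real (tSep {c} c u a b ∩ tSep {b} c u a b) *
          (∏ h ∈ hubs4 c u a b, (prodBernoulli w).real (hSep {c} c u a b h ∩ hSep {b} c u a b h)) -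
        (prodBernoulli w).real (tSep {c} c u a b ∩ tSep {b} c u a b ∩ tSep {u} c u a b) *
          ∏ h ∈ hubs4 c u a b, (prodBernoulli w).real (hSep {c} c u a b h ∩ hSep {b} c u a b h ∩ hSep {u} c u a b h) := by
  have hc : ({c} : Finset V) ⊆ terms4 c u a b := by simp [terms4]
  have hb : ({b} : Finset V) ⊆ terms4 c u a b := by simp [terms4]
  have hu' : ({u} : Finset V) ⊆ terms4 c u a b := by simp [terms4]
  have hset1 : sepEv {c} c u a b ∩ sepEv {b} c u a b =
      (tSep {c} c u a b ∩ tSep {b} c u a b ∩ tSep {b} c u a b) ∩ ⋂ h ∈ hubs4 c u a b, (hSep {c} c u a b h ∩ hSep {b} c u a b h) := by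
    ext ω; simp only [sepEv, mem_inter_iff, mem_iInter]
    constructor
    · rintro ⟨⟨h1, h2⟩, h3, h4⟩; exact ⟨⟨⟨h1, h3⟩, h3⟩, fun h hh => ⟨h2 h hh, h4 h hh⟩⟩
    · rintro ⟨⟨⟨h1, h3⟩, -⟩, h2⟩; exact ⟨⟨h1, fun h hh => (h2 h hh).1⟩, h3, fun h hh => (h2 h hh).2⟩
  have hset2 : sepEv {c} c u a b ∩ sepEv {b} c u a b ∩ sepEv {u} c u a b =
      (tSep {c} c u a b ∩ tSep {b} c u a b ∩ tSep {u} c u a b) ∩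
        ⋂ h ∈ hubs4 c u a b, (hSep {c} c u a b h ∩ hSep {b} c u a b h ∩ hSep {u} c u a b h) := by
    ext ω; simp only [sepEv, mem_inter_iff, mem_iInter]
    constructor
    · rintro ⟨⟨⟨h1, h2⟩, h3, h4⟩, h5, h6⟩; exact ⟨⟨⟨h1, h3⟩, h5⟩, fun h hh => ⟨⟨h2 h hh, h4 h hh⟩, h6 h hh⟩⟩
    · rintro ⟨⟨⟨h1, h3⟩, h5⟩, h2⟩
      exact ⟨⟨⟨h1, fun h hh => (h2 h hh).1.1⟩, h3, fun h hh => (h2 h hh).1.2⟩, h5, fun h hh => (h2 h hh).2⟩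
  have e1 : tSep {c} c u a b ∩ tSep {b} c u a b ∩ tSep {b} c u a b = tSep {c} c u a b ∩ tSep {b} c u a b := by
    rw [Set.inter_assoc, Set.inter_self]
  rw [real_congr_off_null w (real_bad4 w hcov) (fun ω hN => memQ_iff hcu hca hcb hua hub hab hN),
    measureReal_sdiff inter_subset_left MeasurableSet.of_discrete, hset2, hset1,
    real_t3_hInter w hc hb hb fun h _ => (determinedBy_hSep hc h).inter (determinedBy_hSep hb h),
    real_t3_hInter w hc hb hu' fun h _ => ((determinedBy_hSep hc h).inter (determinedBy_hSep hb h)).inter (determinedBy_hSep hu' h), e1]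

/-- `P(A) = P(T_ua)·Π(n+p+d) − P(T_u ∩ T_a)·Π(n+d)` (terminal factors kept). [this work] -/
theorem real_A_vc (hcu : c ≠ u) (hca : c ≠ a) (hua : u ≠ a) (hub : u ≠ b) (hab : a ≠ b)
    (hcov : ∀ x ∈ hubs4 c u a b, ∀ y ∈ hubs4 c u a b, x ≠ y → (w s(x, y) : ℝ) = 0) :
    (prodBernoulli w).real (openConn u a ∩ (openConn u b)ᶜ ∩ ((openConn c u)ᶜ ∩ (openConn c a)ᶜ) : Set (BondConfig V)) =
      (prodBernoulli w).real (tSep {u, a} c u a b) * (∏ h ∈ hubs4 c u a b, (prodBernoulli w).real (hSep {u, a} c u a b h)) -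
        (prodBernoulli w).real (tSep {u} c u a b ∩ tSep {a} c u a b) *
          ∏ h ∈ hubs4 c u a b, (prodBernoulli w).real (hSep {u} c u a b h ∩ hSep {a} c u a b h) := by
  have hua' : ({u, a} : Finset V) ⊆ terms4 c u a b := by
    intro x hx; simp only [Finset.mem_insert, Finset.mem_singleton] at hx; rcases hx with rfl | rfl <;> simp [terms4]
  have hu' : ({u} : Finset V) ⊆ terms4 c u a b := by simp [terms4]
  have ha' : ({a} : Finset V) ⊆ terms4 c u a b := by simp [terms4]
  have hset1 : sepEv {u, a} c u a b =
      (tSep {u, a} c u a b ∩ tSep {u, a} c u a b ∩ tSep {u, a} c u a b) ∩ ⋂ h ∈ hubs4 c u a b, hSep {u, a} c u a b h := by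
    ext ω; simp only [sepEv, mem_inter_iff, mem_iInter, and_self]
  have hset2 : sepEv {u} c u a b ∩ sepEv {a} c u a b =
      (tSep {u} c u a b ∩ tSep {a} c u a b ∩ tSep {a} c u a b) ∩ ⋂ h ∈ hubs4 c u a b, (hSep {u} c u a b h ∩ hSep {a} c u a b h) := by
    ext ω; simp only [sepEv, mem_inter_iff, mem_iInter]
    constructor
    · rintro ⟨⟨h1, h2⟩, h3, h4⟩; exact ⟨⟨⟨h1, h3⟩, h3⟩, fun h hh => ⟨h2 h hh, h4 h hh⟩⟩
    · rintro ⟨⟨⟨h1, h3⟩, -⟩, h2⟩; exact ⟨⟨h1, fun h hh => (h2 h hh).1⟩, h3, fun h hh => (h2 h hh).2⟩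
  have e1 : tSep {u, a} c u a b ∩ tSep {u, a} c u a b ∩ tSep {u, a} c u a b = tSep {u, a} c u a b := by
    rw [Set.inter_self, Set.inter_self]
  have e2 : tSep {u} c u a b ∩ tSep {a} c u a b ∩ tSep {a} c u a b = tSep {u} c u a b ∩ tSep {a} c u a b := by
    rw [Set.inter_assoc, Set.inter_self]
  rw [real_congr_off_null w (real_bad4 w hcov) (fun ω hN => memA_iff hcu hca hua hub hab hN),
    measureReal_sdiff sep_u_a_subset_ua MeasurableSet.of_discrete, hset2, hset1,
    real_t3_hInter w hua' hua' hua' fun h _ => determinedBy_hSep hua' h,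
    real_t3_hInter w hu' ha' ha' fun h _ => (determinedBy_hSep hu' h).inter (determinedBy_hSep ha' h), e1, e2]

/-- `P(C) = P(T_c)·Π γ` (terminal factor kept). [this work] -/
theorem real_C_vc (hcu : c ≠ u) (hca : c ≠ a) (hcb : c ≠ b)
    (hcov : ∀ x ∈ hubs4 c u a b, ∀ y ∈ hubs4 c u a b, x ≠ y → (w s(x, y) : ℝ) = 0) :
    (prodBernoulli w).real ((openConn c u)ᶜ ∩ (openConn c a)ᶜ ∩ (openConn c b)ᶜ : Set (BondConfig V)) =
      (prodBernoulli w).real (tSep {c} c u a b) * ∏ h ∈ hubs4 c u a b, (prodBernoulli w).real (hSep {c} c u a b h) := by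
  have hc : ({c} : Finset V) ⊆ terms4 c u a b := by simp [terms4]
  have hset : sepEv {c} c u a b = (tSep {c} c u a b ∩ tSep {c} c u a b ∩ tSep {c} c u a b) ∩ ⋂ h ∈ hubs4 c u a b, hSep {c} c u a b h := by
    ext ω; simp only [sepEv, mem_inter_iff, mem_iInter, and_self]
  have e1 : tSep {c} c u a b ∩ tSep {c} c u a b ∩ tSep {c} c u a b = tSep {c} c u a b := by rw [Set.inter_self, Set.inter_self]
  rw [real_congr_off_null w (real_bad4 w hcov) (fun ω hN => memC_iff hcu hca hcb hN), hset,
    real_t3_hInter w hc hc hc fun h _ => determinedBy_hSep hc h, e1]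

end products

/-! ## Creator events with the terminal piece -/

section creators
variable (w : Sym2 V → unitInterval) {c u a b : V}

/-- Probability of a hub creator event with the terminal factor: `mB_T · cre_j · Π_{i<j}(n+e)_i · Π_{j<i<K} mB_i`. [this work] -/
theorem real_creatorEv_vc (hcu : c ≠ u) (hca : c ≠ a) (hcb : c ≠ b) (hua : u ≠ a) (hub : u ≠ b) (hab : a ≠ b) {j : ℕ} (hj : j < Fintype.card (hubs4 c u a b)) :
    (prodBernoulli w).real (creatorEv c u a b j) =
      ((1 - (w s(c, b) : ℝ)) * (1 - (w s(u, b) : ℝ)) * (1 - (w s(a, b) : ℝ))) *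
      ((∏ i ∈ range j, (prodBernoulli w).real
          (hSep {b} c u a b (hubAt c u a b i) ∩ {ω | ¬ (s(u, hubAt c u a b i) ∈ ω ∧ s(a, hubAt c u a b i) ∈ ω)})) *
        ((prodBernoulli w).real {ω : BondConfig V | s(u, hubAt c u a b j) ∈ ω ∧ s(a, hubAt c u a b j) ∈ ω ∧ s(b, hubAt c u a b j) ∉ ω} *
          ∏ i ∈ Ico (j + 1) (Fintype.card (hubs4 c u a b)), (prodBernoulli w).real (hSep {b} c u a b (hubAt c u a b i)))) := by
  have hb : ({b} : Finset V) ⊆ terms4 c u a b := by simp [terms4]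
  have e1 : tSep {b} c u a b ∩ tSep {b} c u a b ∩ tSep {b} c u a b = tSep {b} c u a b := by rw [Set.inter_self, Set.inter_self]
  unfold creatorEv
  rw [real_t3_hInter w hb hb hb (fun h _ => determinedBy_creatorH j h), e1, real_T_b w hcu hca hcb hua hub hab,
    prod_hubs_eq_prod_range (fun h => (prodBernoulli w).real (creatorH c u a b j h)),
    ← prod_range_mul_prod_Ico _ hj.le, prod_eq_prod_Ico_succ_bot hj]
  congr 1
  congr 1
  · refine prod_congr rfl fun i hi => ?_
    have hi' : i < j := mem_range.1 hi
    rw [creatorH, hubIdx_hubAt (hi'.trans hj), if_pos hi']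
  · congr 1
    · rw [creatorH, hubIdx_hubAt hj, if_neg (lt_irrefl j), if_pos rfl]
    · refine prod_congr rfl fun i hi => ?_
      have hi' := mem_Ico.1 hi
      rw [creatorH, hubIdx_hubAt hi'.2, if_neg (by omega), if_neg (by omega)]

/-- Probability of the terminal creator event: `cre_T · Π_{i<K} (n+e)_i`. [this work] -/
theorem real_termCreatorEv (hcu : c ≠ u) (hca : c ≠ a) (hcb : c ≠ b) (hua : u ≠ a) (hub : u ≠ b) (hab : a ≠ b) :
    (prodBernoulli w).real (termCreatorEv c u a b) =
      ((1 - (w s(c, b) : ℝ)) * (1 - (w s(u, b) : ℝ)) * (1 - (w s(a, b) : ℝ)) * ((w s(u, a) : ℝ) + (1 - (w s(u, a) : ℝ)) * (w s(c, u) : ℝ) * (w s(c, a) : ℝ))) *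
        ∏ i ∈ range (Fintype.card (hubs4 c u a b)), (prodBernoulli w).real
          (hSep {b} c u a b (hubAt c u a b i) ∩ {ω | ¬ (s(u, hubAt c u a b i) ∈ ω ∧ s(a, hubAt c u a b i) ∈ ω)}) := by
  unfold termCreatorEv
  rw [real_tInter_hInter w (fun ω ω' hF => ?_) (fun h _ => determinedBy_creatorH _ h), real_T_cre w hcu hca hcb hua hub hab,
    prod_hubs_eq_prod_range (fun h => (prodBernoulli w).real (creatorH c u a b (Fintype.card (hubs4 c u a b)) h))]
  · congr 1
    refine prod_congr rfl fun i hi => ?_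
    rw [creatorH, hubIdx_hubAt (mem_range.1 hi), if_pos (mem_range.1 hi)]
  · have hcT : c ∈ terms4 c u a b := by simp [terms4]
    have huT : u ∈ terms4 c u a b := by simp [terms4]
    have haT : a ∈ terms4 c u a b := by simp [terms4]
    have hbT : b ∈ terms4 c u a b := by simp [terms4]
    simp only [mem_inter_iff, mem_setOf_eq]
    rw [hF c hcT b hbT, hF u huT b hbT, hF a haT b hbT, hF u huT a haT, hF c hcT u huT, hF c hcT a haT]

/-- The terminal creator event is disjoint from every hub creator event. [this work] -/
theorem termCreatorEv_disjoint {j : ℕ} (hj : j < Fintype.card (hubs4 c u a b)) :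
    Disjoint (creatorEv c u a b j) (termCreatorEv c u a b) := by
  rw [Set.disjoint_left]
  intro ω h1 h2
  have hm := hubAt_mem (c := c) (u := u) (a := a) (b := b) hj
  have e1 := (mem_iInter₂.1 h1.2) (hubAt c u a b j) hm
  have e2 := (mem_iInter₂.1 h2.2) (hubAt c u a b j) hm
  rw [creatorH, hubIdx_hubAt hj, if_neg (lt_irrefl _), if_pos rfl] at e1
  rw [creatorH, hubIdx_hubAt hj, if_pos hj] at e2
  exact e2.2 ⟨e1.1, e1.2.1⟩

/-- The terminal creator event lies in `F ∩ {c≁b}` off the null event. [this work] -/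
theorem termCreatorEv_subset (hcu : c ≠ u) (hca : c ≠ a) (hcb : c ≠ b) (hua : u ≠ a) (hub : u ≠ b) (hab : a ≠ b) :
    termCreatorEv c u a b ⊆ (openConn u a ∩ (openConn u b)ᶜ ∩ (openConn c b)ᶜ : Set (BondConfig V)) ∪ bad4 c u a b := by
  intro ω hω
  by_cases hN : ω ∈ bad4 c u a b
  · exact Or.inr hN
  refine Or.inl (memB_of hcb hub hab hN ?_ ?_)
  · refine ⟨(mem_tSep_b hcu hca hcb hua hub hab).2 hω.1.1, mem_iInter₂.2 fun h hh => ?_⟩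
    have e := (mem_iInter₂.1 hω.2) h hh
    rw [creatorH, if_pos (hubIdx_lt hh)] at e
    exact e.1
  · rcases hω.1.2 with hua' | ⟨hcu', hca'⟩
    · exact SimpleGraph.Adj.reachable ((openGraph_adj ω u a).2 ⟨hua', hua⟩)
    · have h1 : (openGraph ω).Reachable u c :=
        SimpleGraph.Adj.reachable ((openGraph_adj ω u c).2 ⟨by rw [Sym2.eq_swap]; exact hcu', fun e => hcu e.symm⟩)
      exact h1.trans (SimpleGraph.Adj.reachable ((openGraph_adj ω c a).2 ⟨hca', hca⟩))

/-- **`B̃ ≤ B` with the terminal piece.** [this work] -/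
theorem sum_creator_le_B_vc (hcu : c ≠ u) (hca : c ≠ a) (hcb : c ≠ b) (hua : u ≠ a) (hub : u ≠ b) (hab : a ≠ b)
    (hcov : ∀ x ∈ hubs4 c u a b, ∀ y ∈ hubs4 c u a b, x ≠ y → (w s(x, y) : ℝ) = 0) :
    (∑ j ∈ range (Fintype.card (hubs4 c u a b)), (prodBernoulli w).real (creatorEv c u a b j)) +
        (prodBernoulli w).real (termCreatorEv c u a b) ≤
      (prodBernoulli w).real (openConn u a ∩ (openConn u b)ᶜ ∩ (openConn c b)ᶜ : Set (BondConfig V)) := by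
  have hdisj : Disjoint (⋃ j ∈ range (Fintype.card (hubs4 c u a b)), creatorEv c u a b j) (termCreatorEv c u a b) := by
    rw [Set.disjoint_iUnion₂_left]
    exact fun j hj => termCreatorEv_disjoint (mem_range.1 hj)
  rw [← measureReal_biUnion_finset creatorEv_disjoint (fun _ _ => MeasurableSet.of_discrete),
    ← measureReal_union hdisj MeasurableSet.of_discrete (measure_ne_top _ _) (measure_ne_top _ _)]
  calc (prodBernoulli w).real ((⋃ j ∈ range (Fintype.card (hubs4 c u a b)), creatorEv c u a b j) ∪ termCreatorEv c u a b)
      ≤ (prodBernoulli w).real ((openConn u a ∩ (openConn u b)ᶜ ∩ (openConn c b)ᶜ : Set (BondConfig V)) ∪ bad4 c u a b) :=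
        measureReal_mono (union_subset (iUnion₂_subset fun j hj => creatorEv_subset hcu hca hcb hua hub hab (mem_range.1 hj))
          (termCreatorEv_subset hcu hca hcb hua hub hab))
    _ ≤ (prodBernoulli w).real (openConn u a ∩ (openConn u b)ᶜ ∩ (openConn c b)ᶜ : Set (BondConfig V)) + (prodBernoulli w).real (bad4 c u a b) := measureReal_union_le _ _
    _ = _ := by rw [real_bad4 w hcov, add_zero]

end creators

/-! ## Assembly -/

section main
variable (w : Sym2 V → unitInterval) {c u a b : V}

/-- **THEOREM H4 (vertex-cover form): the super-terminal quartic law `V4` on every finite weighted graph whose positive-weight pairs all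
meet `{c,u,a,b}`** (hub–hub pairs of weight `0`; terminal–terminal pairs arbitrary). [this work] -/
theorem superTerminalQuartic_vertexCover (hcu : c ≠ u) (hca : c ≠ a) (hcb : c ≠ b) (hua : u ≠ a) (hub : u ≠ b) (hab : a ≠ b)
    (hcov : ∀ x ∈ hubs4 c u a b, ∀ y ∈ hubs4 c u a b, x ≠ y → (w s(x, y) : ℝ) = 0) :
    (prodBernoulli w).real (openConn u a ∩ (openConn u b)ᶜ ∩ ((openConn c u)ᶜ ∩ (openConn c a)ᶜ ∩ (openConn c b)ᶜ) : Set (BondConfig V)) ^ 4 ≤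
      (prodBernoulli w).real (openConn u a ∩ (openConn u b)ᶜ ∩ ((openConn c u)ᶜ ∩ (openConn c a)ᶜ) : Set (BondConfig V)) ^ 2 *
        (prodBernoulli w).real (openConn u a ∩ (openConn u b)ᶜ ∩ (openConn c b)ᶜ : Set (BondConfig V)) ^ 2 *
          (prodBernoulli w).real ((openConn c u)ᶜ ∩ (openConn c a)ᶜ ∩ (openConn c b)ᶜ : Set (BondConfig V)) := by
  set K := Fintype.card (hubs4 c u a b) with hK
  -- piece sequences: hubs at indices `< K`, the terminal piece at index `K`
  set nS : ℕ → ℝ := fun i => if i < K then ((1 - (w s(u, hubAt c u a b i) : ℝ)) * (1 - (w s(a, hubAt c u a b i) : ℝ)) * (1 - (w s(b, hubAt c u a b i) : ℝ)) + (1 - (w s(c, hubAt c u a b i) : ℝ)) * ((w s(u, hubAt c u a b i) : ℝ) * (1 - (w s(a, hubAt c u a b i) : ℝ)) * (1 - (w s(b, hubAt c u a b i) : ℝ)) + (1 - (w s(u, hubAt c u a b i) : ℝ)) * (w s(a, hubAt c u a b i) : ℝ) * (1 - (w s(b, hubAt c u a b i) : ℝ)) + (1 - (w s(u, hubAt c u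 a b i) : ℝ)) * (1 - (w s(a, hubAt c u a b i) : ℝ)) * (w s(b, hubAt c u a b i) : ℝ))) else ((1 - (w s(c, u) : ℝ)) * (1 - (w s(c, a) : ℝ)) * (1 - (w s(c, b) : ℝ)) * (1 - (w s(u, a) : ℝ)) * (1 - (w s(u, b) : ℝ)) * (1 - (w s(a, b) : ℝ))) with hnS
  set pS : ℕ → ℝ := fun i => if i < K then ((1 - (w s(c, hubAt c u a b i) : ℝ)) * (w s(u, hubAt c u a b i) : ℝ) * (w s(a, hubAt c u a b i) : ℝ) * (1 - (w s(b, hubAt c u a b i) : ℝ))) else ((1 - (w s(c, u) : ℝ)) * (1 - (w s(c, a) : ℝ)) * (1 - (w s(c, b) : ℝ)) * (w s(u, a) : ℝ) * (1 - (w s(u, b) : ℝ)) * (1 - (w s(a, b) : ℝ))) with hpS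
  set dS : ℕ → ℝ := fun i => if i < K then ((w s(c, hubAt c u a b i) : ℝ) * (1 - (w s(u, hubAt c u a b i) : ℝ)) * (1 - (w s(a, hubAt c u a b i) : ℝ)) * (w s(b, hubAt c u a b i) : ℝ)) else ((1 - (w s(c, u) : ℝ)) * (1 - (w s(c, a) : ℝ)) * (w s(c, b) : ℝ) * (1 - (w s(u, a) : ℝ)) * (1 - (w s(u, b) : ℝ)) * (1 - (w s(a, b) : ℝ))) with hdS
  set fS : ℕ → ℝ := fun i => if i < K then (0 : ℝ) else ((1 - (w s(c, u) : ℝ)) * (1 - (w s(c, a) : ℝ)) * (w s(c, b) : ℝ) * (w s(u, a) : ℝ) * (1 - (w s(u, b) : ℝ)) * (1 - (w s(a, b) : ℝ))) with hfS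
  set eS : ℕ → ℝ := fun i => if i < K then ((w s(c, hubAt c u a b i) : ℝ) * (w s(u, hubAt c u a b i) : ℝ) * (1 - (w s(a, hubAt c u a b i) : ℝ)) * (1 - (w s(b, hubAt c u a b i) : ℝ)) + (w s(c, hubAt c u a b i) : ℝ) * (1 - (w s(u, hubAt c u a b i) : ℝ)) * (w s(a, hubAt c u a b i) : ℝ) * (1 - (w s(b, hubAt c u a b i) : ℝ))) else (((w s(c, u) : ℝ) * (1 - (w s(c, a) : ℝ)) + (1 - (w s(c, u) : ℝ)) * (w s(c, a) : ℝ)) * (1 - (w s(c, b) : ℝ)) * (1 - (w s(u, a) : ℝ)) * (1 - (w s(u, b) : ℝ)) * (1 - (w s(a, b) : ℝ))) with heS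
  set creS : ℕ → ℝ := fun i => if i < K then ((1 - (w s(c, hubAt c u a b i) : ℝ)) * (w s(u, hubAt c u a b i) : ℝ) * (w s(a, hubAt c u a b i) : ℝ) * (1 - (w s(b, hubAt c u a b i) : ℝ))) + ((w s(c, hubAt c u a b i) : ℝ) * (w s(u, hubAt c u a b i) : ℝ) * (w s(a, hubAt c u a b i) : ℝ) * (1 - (w s(b, hubAt c u a b i) : ℝ))) else ((1 - (w s(c, b) : ℝ)) * (1 - (w s(u, b) : ℝ)) * (1 - (w s(a, b) : ℝ)) * ((w s(u, a) : ℝ) + (1 - (w s(u, a) : ℝ)) * (w s(c, u) : ℝ) * (w s(c, a) : ℝ))) with hcreS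
  set mBS : ℕ → ℝ := fun i => if i < K then ((1 - (w s(b, hubAt c u a b i) : ℝ)) + (1 - (w s(c, hubAt c u a b i) : ℝ)) * (1 - (w s(u, hubAt c u a b i) : ℝ)) * (1 - (w s(a, hubAt c u a b i) : ℝ)) * (w s(b, hubAt c u a b i) : ℝ)) else ((1 - (w s(c, b) : ℝ)) * (1 - (w s(u, b) : ℝ)) * (1 - (w s(a, b) : ℝ))) with hmBS
  set gS : ℕ → ℝ := fun i => if i < K then ((1 - (w s(c, hubAt c u a b i) : ℝ)) + (w s(c, hubAt c u a b i) : ℝ) * (1 - (w s(u, hubAt c u a b i) : ℝ)) * (1 - (w s(a, hubAt c u a b i) : ℝ)) * (1 - (w s(b, hubAt c u a b i) : ℝ))) else ((1 - (w s(c, u) : ℝ)) * (1 - (w s(c, a) : ℝ)) * (1 - (w s(c, b) : ℝ))) with hgS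
  set vS : ℕ → ℝ := fun i => Real.sqrt (gS i) with hvS
  have h01 : ∀ e : Sym2 V, 0 ≤ (w e : ℝ) ∧ (w e : ℝ) ≤ 1 := fun e => ⟨(w e).2.1, (w e).2.2⟩
  have HN := fun i => hub_nonneg (r := (w s(c, hubAt c u a b i) : ℝ)) (s₁ := (w s(u, hubAt c u a b i) : ℝ))
    (a₁ := (w s(a, hubAt c u a b i) : ℝ)) (b₁ := (w s(b, hubAt c u a b i) : ℝ))
    (h01 _).1 (h01 _).2 (h01 _).1 (h01 _).2 (h01 _).1 (h01 _).2 (h01 _).1 (h01 _).2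
  have HT := termPiece (h01 s(c, u)).1 (h01 s(c, u)).2 (h01 s(c, a)).1 (h01 s(c, a)).2 (h01 s(c, b)).1 (h01 s(c, b)).2
    (h01 s(u, a)).1 (h01 s(u, a)).2 (h01 s(u, b)).1 (h01 s(u, b)).2 (h01 s(a, b)).1 (h01 s(a, b)).2
  have hcase : ∀ i < K + 1, i < K ∨ i = K := fun i hi => by omega
  have Hn : ∀ i < K + 1, 0 ≤ nS i := by
    intro i hi
    rcases hcase i hi with h | rfl
    · simp only [hnS, if_pos h]
      exact (HN i).1
    · simp only [hnS, lt_irrefl, if_false]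
      exact HT.1.1
  have Hp : ∀ i < K + 1, 0 ≤ pS i := by
    intro i hi
    rcases hcase i hi with h | rfl
    · simp only [hpS, if_pos h]
      exact (HN i).2.1
    · simp only [hpS, lt_irrefl, if_false]
      exact HT.1.2.1
  have Hd : ∀ i < K + 1, 0 ≤ dS i := by
    intro i hi
    rcases hcase i hi with h | rfl
    · simp only [hdS, if_pos h]
      exact (HN i).2.2.1
    · simp only [hdS, lt_irrefl, if_false]
      exact HT.1.2.2.1
  have Hf : ∀ i < K + 1, 0 ≤ fS i := by
    intro i hi
    rcases hcase i hi with h | rfl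
    · simp only [hfS, if_pos h]
      exact le_refl 0
    · simp only [hfS, lt_irrefl, if_false]
      exact HT.1.2.2.2.1
  have He : ∀ i < K + 1, 0 ≤ eS i := by
    intro i hi
    rcases hcase i hi with h | rfl
    · simp only [heS, if_pos h]
      exact (HN i).2.2.2.1
    · simp only [heS, lt_irrefl, if_false]
      exact HT.1.2.2.2.2.1
  have Hcre : ∀ i < K + 1, 0 ≤ creS i := by
    intro i hi
    rcases hcase i hi with h | rfl
    · simp only [hcreS, if_pos h]
      exact (HN i).2.2.2.2.1
    · simp only [hcreS, lt_irrefl, if_false]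
      exact HT.1.2.2.2.2.2.1
  have HmB : ∀ i < K + 1, 0 ≤ mBS i := by
    intro i hi
    rcases hcase i hi with h | rfl
    · simp only [hmBS, if_pos h]
      exact (HN i).2.2.2.2.2.1
    · simp only [hmBS, lt_irrefl, if_false]
      exact HT.1.2.2.2.2.2.2.1
  have Hpe : ∀ i < K + 1, pS i ^ 2 ≤ (pS i + fS i) * creS i * vS i := by
    intro i hi
    rcases hcase i hi with h | rfl
    · simp only [hpS, hfS, hcreS, hvS, hgS, if_pos h, add_zero]
      exact SuperTerminalQuarticOneHub.hub_eq_sqrt (h01 _).1 (h01 _).2 (h01 _).1 (h01 _).2 (h01 _).1 (h01 _).2 (h01 _).1 (h01 _).2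
    · simp only [hpS, hfS, hcreS, hvS, hgS, lt_irrefl, if_false]
      exact HT.2.1
  have Hlt : ∀ i < K + 1, nS i ^ 2 ≤ (nS i + dS i) * (nS i + eS i) * vS i := by
    intro i hi
    rcases hcase i hi with h | rfl
    · simp only [hnS, hdS, heS, hvS, hgS, if_pos h]
      exact SuperTerminalQuarticOneHub.hub_lt_sqrt (h01 _).1 (h01 _).2 (h01 _).1 (h01 _).2 (h01 _).1 (h01 _).2 (h01 _).1 (h01 _).2
    · simp only [hnS, hdS, heS, hvS, hgS, lt_irrefl, if_false]
      exact HT.2.2.1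
  have Hgt : ∀ i < K + 1, (nS i + pS i) ^ 2 ≤ (nS i + pS i + dS i + fS i) * mBS i * vS i := by
    intro i hi
    rcases hcase i hi with h | rfl
    · simp only [hnS, hpS, hdS, hfS, hmBS, hvS, hgS, if_pos h, add_zero]
      exact SuperTerminalQuarticOneHub.hub_gt_sqrt (h01 _).1 (h01 _).2 (h01 _).1 (h01 _).2 (h01 _).1 (h01 _).2 (h01 _).1 (h01 _).2
    · simp only [hnS, hpS, hdS, hfS, hmBS, hvS, hgS, lt_irrefl, if_false]
      exact HT.2.2.2
  have INV := SuperTerminalQuarticHubAlgebra.invariant_range nS pS dS fS eS creS mBS vS (K + 1) Hn Hp Hd Hf He Hcre HmB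
    (fun i _ => Real.sqrt_nonneg _) Hpe Hlt Hgt
  obtain ⟨hI, -⟩ := INV
  -- products over `range (K+1)`: hubs times the terminal factor
  have split : ∀ (F : ℕ → ℝ) (G : ℕ → ℝ) (t : ℝ), (∀ i, F i = if i < K then G i else t) →
      ∏ i ∈ range (K + 1), F i = (∏ i ∈ range K, G i) * t := by
    intro F G t hF
    rw [prod_range_succ, hF K, if_neg (lt_irrefl K)]
    congr 1
    exact prod_congr rfl fun i hi => by rw [hF i, if_pos (mem_range.1 hi)]
  have eQ : (prodBernoulli w).real (openConn u a ∩ (openConn u b)ᶜ ∩ ((openConn c u)ᶜ ∩ (openConn c a)ᶜ ∩ (openConn c b)ᶜ) : Set (BondConfig V)) = (∏ i ∈ range (K + 1), (nS i + pS i)) - ∏ i ∈ range (K + 1), nS i := by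
    rw [real_Q_vc w hcu hca hcb hua hub hab hcov, real_T_cb w hcu hca hcb hua hub hab, real_T_cbu w hcu hca hcb hua hub hab,
      prod_congr rfl (fun h _ => real_hSep_cb w hcu hca hcb hua hub hab), prod_congr rfl (fun h _ => real_hSep_cbu w hcu hca hcb hua hub hab),
      prod_hubs_eq_prod_range, prod_hubs_eq_prod_range,
      split (fun i => nS i + pS i) (fun i => ((1 - (w s(u, hubAt c u a b i) : ℝ)) * (1 - (w s(a, hubAt c u a b i) : ℝ)) * (1 - (w s(b, hubAt c u a b i) : ℝ)) + (1 - (w s(c, hubAt c u a b i) : ℝ)) * ((w s(u, hubAt c u a b i) : ℝ) * (1 - (w s(a, hubAt c u a b i) : ℝ)) * (1 - (w s(b, hubAt c u a b i) : ℝ)) + (1 - (w s(u, hubAt c u a b i) : ℝ)) * (w s(a, hubAt c u a b i) : ℝ) * (1 - (w s(b, hubAt c u a b i) : ℝ)) + (1 - (w s(u, hubAt c u a b i) : ℝ)) * (1 - (w s(a, hubAt c u a b i) : ℝ)) * (w s(b, hubAt c u a b i) : ℝ))) + ((1 - (w s(c, hubAt c u a b i) : ℝ)) * (w s(u, hubAt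 c u a b i) : ℝ) * (w s(a, hubAt c u a b i) : ℝ) * (1 - (w s(b, hubAt c u a b i) : ℝ)))) (((1 - (w s(c, u) : ℝ)) * (1 - (w s(c, a) : ℝ)) * (1 - (w s(c, b) : ℝ)) * (1 - (w s(u, a) : ℝ)) * (1 - (w s(u, b) : ℝ)) * (1 - (w s(a, b) : ℝ))) + ((1 - (w s(c, u) : ℝ)) * (1 - (w s(c, a) : ℝ)) * (1 - (w s(c, b) : ℝ)) * (w s(u, a) : ℝ) * (1 - (w s(u, b) : ℝ)) * (1 - (w s(a, b) : ℝ)))) (fun i => by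
        simp only [hnS, hpS]; split_ifs <;> rfl),
      split nS (fun i => ((1 - (w s(u, hubAt c u a b i) : ℝ)) * (1 - (w s(a, hubAt c u a b i) : ℝ)) * (1 - (w s(b, hubAt c u a b i) : ℝ)) + (1 - (w s(c, hubAt c u a b i) : ℝ)) * ((w s(u, hubAt c u a b i) : ℝ) * (1 - (w s(a, hubAt c u a b i) : ℝ)) * (1 - (w s(b, hubAt c u a b i) : ℝ)) + (1 - (w s(u, hubAt c u a b i) : ℝ)) * (w s(a, hubAt c u a b i) : ℝ) * (1 - (w s(b, hubAt c u a b i) : ℝ)) + (1 - (w s(u, hubAt c u a b i) : ℝ)) * (1 - (w s(a, hubAt c u a b i) : ℝ)) * (w s(b, hubAt c u a b i) : ℝ)))) ((1 - (w s(c, u) : ℝ)) * (1 - (w s(c, a) : ℝ)) * (1 - (w s(c, b) : ℝ)) * (1 - (w s(u, a) : ℝ)) * (1 - (w s(u, b) : ℝ)) * (1 - (w s(a, b) : ℝ))) (fun i => by simp only [hnS])]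
    ring
  have eA : (prodBernoulli w).real (openConn u a ∩ (openConn u b)ᶜ ∩ ((openConn c u)ᶜ ∩ (openConn c a)ᶜ) : Set (BondConfig V)) = (∏ i ∈ range (K + 1), (nS i + pS i + dS i + fS i)) - ∏ i ∈ range (K + 1), (nS i + dS i) := by
    rw [real_A_vc w hcu hca hua hub hab hcov, real_T_ua w hcu hca hcb hua hub hab, real_T_u_a w hcu hca hcb hua hub hab,
      prod_congr rfl (fun h _ => real_hSep_ua w hcu hca hcb hua hub hab), prod_congr rfl (fun h _ => real_hSep_u_a w hcu hca hcb hua hub hab),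
      prod_hubs_eq_prod_range, prod_hubs_eq_prod_range,
      split (fun i => nS i + pS i + dS i + fS i) (fun i => ((1 - (w s(u, hubAt c u a b i) : ℝ)) * (1 - (w s(a, hubAt c u a b i) : ℝ)) * (1 - (w s(b, hubAt c u a b i) : ℝ)) + (1 - (w s(c, hubAt c u a b i) : ℝ)) * ((w s(u, hubAt c u a b i) : ℝ) * (1 - (w s(a, hubAt c u a b i) : ℝ)) * (1 - (w s(b, hubAt c u a b i) : ℝ)) + (1 - (w s(u, hubAt c u a b i) : ℝ)) * (w s(a, hubAt c u a b i) : ℝ) * (1 - (w s(b, hubAt c u a b i) : ℝ)) + (1 - (w s(u, hubAt c u a b i) : ℝ)) * (1 - (w s(a, hubAt c u a b i) : ℝ)) * (w s(b, hubAt c u a b i) : ℝ))) + ((1 - (w s(c, hubAt c u a b i) : ℝ)) * (w s(u, hubAt c u a b i) : ℝ) * (w s(a, hubAt c u a b i) : ℝ) * (1 - (w s(b, hubAt c u a b i) : ℝ))) + ((w s(c, hubAt c u a b i) : ℝ) * (1 - (w s(u, hubAt c u a b i) : ℝ)) * (1 - (w s(a, hubAt c u a b i) : ℝ)) * (w s(b,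 hubAt c u a b i) : ℝ)) + 0) (((1 - (w s(c, u) : ℝ)) * (1 - (w s(c, a) : ℝ)) * (1 - (w s(c, b) : ℝ)) * (1 - (w s(u, a) : ℝ)) * (1 - (w s(u, b) : ℝ)) * (1 - (w s(a, b) : ℝ))) + ((1 - (w s(c, u) : ℝ)) * (1 - (w s(c, a) : ℝ)) * (1 - (w s(c, b) : ℝ)) * (w s(u, a) : ℝ) * (1 - (w s(u, b) : ℝ)) * (1 - (w s(a, b) : ℝ))) + ((1 - (w s(c, u) : ℝ)) * (1 - (w s(c, a) : ℝ)) * (w s(c, b) : ℝ) * (1 - (w s(u, a) : ℝ)) * (1 - (w s(u, b) : ℝ)) * (1 - (w s(a, b) : ℝ))) + ((1 - (w s(c, u) : ℝ)) * (1 - (w s(c, a) : ℝ)) * (w s(c, b) : ℝ) * (w s(u, a) : ℝ) * (1 - (w s(u, b) : ℝ)) * (1 - (w s(a, b) : ℝ)))) (fun i => by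
        simp only [hnS, hpS, hdS, hfS]; split_ifs <;> rfl),
      split (fun i => nS i + dS i) (fun i => ((1 - (w s(u, hubAt c u a b i) : ℝ)) * (1 - (w s(a, hubAt c u a b i) : ℝ)) * (1 - (w s(b, hubAt c u a b i) : ℝ)) + (1 - (w s(c, hubAt c u a b i) : ℝ)) * ((w s(u, hubAt c u a b i) : ℝ) * (1 - (w s(a, hubAt c u a b i) : ℝ)) * (1 - (w s(b, hubAt c u a b i) : ℝ)) + (1 - (w s(u, hubAt c u a b i) : ℝ)) * (w s(a, hubAt c u a b i) : ℝ) * (1 - (w s(b, hubAt c u a b i) : ℝ)) + (1 - (w s(u, hubAt c u a b i) : ℝ)) * (1 - (w s(a, hubAt c u a b i) : ℝ)) * (w s(b, hubAt c u a b i) : ℝ))) + ((w s(c, hubAt c u a b i) : ℝ) * (1 - (w s(u, hubAt c u a b i) : ℝ)) * (1 - (w s(a, hubAt c u a b i) : ℝ)) * (w s(b, hubAt c u a b i) : ℝ))) (((1 - (w s(c, u) : ℝ)) * (1 - (w s(c, a) : ℝ)) * (1 - (w s(c, b) : ℝ)) * (1 - (w s(u, a) : ℝ)) * (1 - (w s(u,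 b) : ℝ)) * (1 - (w s(a, b) : ℝ))) + ((1 - (w s(c, u) : ℝ)) * (1 - (w s(c, a) : ℝ)) * (w s(c, b) : ℝ) * (1 - (w s(u, a) : ℝ)) * (1 - (w s(u, b) : ℝ)) * (1 - (w s(a, b) : ℝ)))) (fun i => by simp only [hnS, hdS]; split_ifs <;> rfl)]
    simp only [add_zero]
    ring
  have eC : (prodBernoulli w).real ((openConn c u)ᶜ ∩ (openConn c a)ᶜ ∩ (openConn c b)ᶜ : Set (BondConfig V)) = ∏ i ∈ range (K + 1), gS i := by
    rw [real_C_vc w hcu hca hcb hcov, real_T_c w hcu hca hcb hua hub hab, prod_congr rfl (fun h _ => real_hSep_c w hcu hca hcb hua hub hab), prod_hubs_eq_prod_range,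
      split gS (fun i => ((1 - (w s(c, hubAt c u a b i) : ℝ)) + (w s(c, hubAt c u a b i) : ℝ) * (1 - (w s(u, hubAt c u a b i) : ℝ)) * (1 - (w s(a, hubAt c u a b i) : ℝ)) * (1 - (w s(b, hubAt c u a b i) : ℝ)))) ((1 - (w s(c, u) : ℝ)) * (1 - (w s(c, a) : ℝ)) * (1 - (w s(c, b) : ℝ))) (fun i => by simp only [hgS])]
    ring
  have eV : (∏ i ∈ range (K + 1), vS i) ^ 2 = (prodBernoulli w).real ((openConn c u)ᶜ ∩ (openConn c a)ᶜ ∩ (openConn c b)ᶜ : Set (BondConfig V)) := by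
    rw [eC, ← Finset.prod_pow]
    refine prod_congr rfl fun i hi => ?_
    simp only [hvS]
    refine Real.sq_sqrt ?_
    rcases hcase i (mem_range.1 hi) with h | rfl
    · simp only [hgS, if_pos h]; exact (HN i).2.2.2.2.2.2
    · simp only [hgS, lt_irrefl, if_false]; exact HT.1.2.2.2.2.2.2.2
  have eBt : (∑ j ∈ range (K + 1), creS j * (∏ i ∈ range j, (nS i + eS i)) * ∏ i ∈ Ico (j + 1) (K + 1), mBS i) =
      (∑ j ∈ range K, (prodBernoulli w).real (creatorEv c u a b j)) + (prodBernoulli w).real (termCreatorEv c u a b) := by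
    rw [sum_range_succ, Ico_self, Finset.prod_empty, mul_one]
    congr 1
    · refine sum_congr rfl fun j hj => ?_
      have hj' : j < K := mem_range.1 hj
      rw [real_creatorEv_vc w hcu hca hcb hua hub hab hj', prod_congr rfl (fun i _ => real_prefix w hcu hca hcb hua hub hab), real_creator w hcu hca hcb hua hub hab,
        prod_congr rfl (fun i _ => real_hSep_b w hcu hca hcb hua hub hab), prod_Ico_succ_top (by omega : j + 1 ≤ K)]
      have ecre : creS j = ((1 - (w s(c, hubAt c u a b j) : ℝ)) * (w s(u, hubAt c u a b j) : ℝ) * (w s(a, hubAt c u a b j) : ℝ) * (1 - (w s(b, hubAt c u a b j) : ℝ))) + ((w s(c, hubAt c u a b j) : ℝ) * (w s(u, hubAt c u a b j) : ℝ) * (w s(a, hubAt c u a b j) : ℝ) * (1 - (w s(b, hubAt c u a b j) : ℝ))) := by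
        simp only [hcreS, if_pos hj']
      have epre : ∀ i ∈ range j, nS i + eS i = ((1 - (w s(u, hubAt c u a b i) : ℝ)) * (1 - (w s(a, hubAt c u a b i) : ℝ)) * (1 - (w s(b, hubAt c u a b i) : ℝ)) + (1 - (w s(c, hubAt c u a b i) : ℝ)) * ((w s(u, hubAt c u a b i) : ℝ) * (1 - (w s(a, hubAt c u a b i) : ℝ)) * (1 - (w s(b, hubAt c u a b i) : ℝ)) + (1 - (w s(u, hubAt c u a b i) : ℝ)) * (w s(a, hubAt c u a b i) : ℝ) * (1 - (w s(b, hubAt c u a b i) : ℝ)) + (1 - (w s(u, hubAt c u a b i) : ℝ)) * (1 - (w s(a, hubAt c u a b i) : ℝ)) * (w s(b, hubAt c u a b i) : ℝ))) + ((w s(c, hubAt c u a b i) : ℝ) * (w s(u, hubAt c u a b i) : ℝ) * (1 - (w s(a, hubAt c u a b i) : ℝ)) * (1 - (w s(b, hubAt c u a b i) : ℝ)) + (w s(c, hubAt c u a b i) : ℝ) * (1 - (w s(u, hubAt c u a b i) : ℝ)) * (w s(a, hubAt c u a b i) : ℝ) * (1 - (w s(b, hubAt c u a b i) : ℝ)))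 := fun i hi => by
        have : i < K := (mem_range.1 hi).trans hj'
        simp only [hnS, heS, if_pos this]
      have esuf : ∀ i ∈ Finset.Ico (j + 1) K, mBS i = ((1 - (w s(b, hubAt c u a b i) : ℝ)) + (1 - (w s(c, hubAt c u a b i) : ℝ)) * (1 - (w s(u, hubAt c u a b i) : ℝ)) * (1 - (w s(a, hubAt c u a b i) : ℝ)) * (w s(b, hubAt c u a b i) : ℝ)) := fun i hi => by
        simp only [hmBS, if_pos (Finset.mem_Ico.1 hi).2]
      have eK : mBS K = ((1 - (w s(c, b) : ℝ)) * (1 - (w s(u, b) : ℝ)) * (1 - (w s(a, b) : ℝ))) := by simp only [hmBS, lt_irrefl, if_false]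
      rw [ecre, prod_congr rfl epre, prod_congr rfl esuf, eK]
      ring
    · have ecre : creS K = ((1 - (w s(c, b) : ℝ)) * (1 - (w s(u, b) : ℝ)) * (1 - (w s(a, b) : ℝ)) * ((w s(u, a) : ℝ) + (1 - (w s(u, a) : ℝ)) * (w s(c, u) : ℝ) * (w s(c, a) : ℝ))) := by simp only [hcreS, lt_irrefl, if_false]
      have epre : ∀ i ∈ range K, nS i + eS i = ((1 - (w s(u, hubAt c u a b i) : ℝ)) * (1 - (w s(a, hubAt c u a b i) : ℝ)) * (1 - (w s(b, hubAt c u a b i) : ℝ)) + (1 - (w s(c, hubAt c u a b i) : ℝ)) * ((w s(u, hubAt c u a b i) : ℝ) * (1 - (w s(a, hubAt c u a b i) : ℝ)) * (1 - (w s(b, hubAt c u a b i) : ℝ)) + (1 - (w s(u, hubAt c u a b i) : ℝ)) * (w s(a, hubAt c u a b i) : ℝ) * (1 - (w s(b, hubAt c u a b i) : ℝ)) + (1 - (w s(u, hubAt c u a b i) : ℝ)) * (1 - (w s(a, hubAt c u a b i) : ℝ)) * (w s(b, hubAt c u a b i) : ℝ))) + ((w s(c, hubAt c u a b i) : ℝ)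 * (w s(u, hubAt c u a b i) : ℝ) * (1 - (w s(a, hubAt c u a b i) : ℝ)) * (1 - (w s(b, hubAt c u a b i) : ℝ)) + (w s(c, hubAt c u a b i) : ℝ) * (1 - (w s(u, hubAt c u a b i) : ℝ)) * (w s(a, hubAt c u a b i) : ℝ) * (1 - (w s(b, hubAt c u a b i) : ℝ))) := fun i hi => by
        simp only [hnS, heS, if_pos (mem_range.1 hi)]
      rw [ecre, prod_congr rfl epre, real_termCreatorEv w hcu hca hcb hua hub hab, prod_congr rfl (fun i _ => real_prefix w hcu hca hcb hua hub hab)]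
  have hBt : 0 ≤ (∑ j ∈ range K, (prodBernoulli w).real (creatorEv c u a b j)) + (prodBernoulli w).real (termCreatorEv c u a b) :=
    add_nonneg (sum_nonneg fun _ _ => measureReal_nonneg) measureReal_nonneg
  rw [eBt, ← eQ, ← eA] at hI
  exact SuperTerminalQuarticHubAlgebra.superTerminalQuartic_of_invariant measureReal_nonneg hBt
    (sum_creator_le_B_vc w hcu hca hcb hua hub hab hcov) (prod_nonneg fun _ _ => Real.sqrt_nonneg _) eV hI

/-- **Corollary: `P3_{1/2}` on every finite weighted graph with vertex cover `{c,u,a,b}`.** [this work] -/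
theorem p3_half_vertexCover (hcu : c ≠ u) (hca : c ≠ a) (hcb : c ≠ b) (hua : u ≠ a) (hub : u ≠ b) (hab : a ≠ b)
    (hcov : ∀ x ∈ hubs4 c u a b, ∀ y ∈ hubs4 c u a b, x ≠ y → (w s(x, y) : ℝ) = 0) :
    (prodBernoulli w).real (openConn u a ∩ (openConn u b)ᶜ : Set (BondConfig V)) *
        (prodBernoulli w).real ((openConn c u)ᶜ ∩ (openConn c a)ᶜ ∩ (openConn c b)ᶜ : Set (BondConfig V))ᶜ ≤
      2 * (prodBernoulli w).real (openConn u a ∩ (openConn u b)ᶜ ∩ ((openConn c u)ᶜ ∩ (openConn c a)ᶜ ∩ (openConn c b)ᶜ)ᶜ : Set (BondConfig V)) :=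
  SuperTerminalQuarticFace.p3_half_of_superTerminalQuartic w u a b c (superTerminalQuartic_vertexCover w hcu hca hcb hua hub hab hcov)

end main

end Summit.CriticalPhenomena.PercolationContinuityZ3.Theorems.SuperTerminalQuarticHubGraphsVC
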